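import Summits.Ventures.Crystal3D.Kissing125.Geometry3
import HarnessLib

/-!
# The class `𝒱(5/2)`, its `KConf` at `κ = 7/32`, and rigidity at `σ = 7/8` — K25 copy at `κ = 7/32` (`h = 5/4`), part 4/4

HONEST FRAMING (cell pub-crystal3d, K-path at `h = 5/4`): this is NOT a result printed by Hales.  It is his
METHOD (arXiv:1209.6043, Theorem 3: the main estimate + the classification of the contact graphs of kissing
configurations, in the tree's form of a verified interval-arithmetic growth search, `Literature/…/KissingSearch*.lean`)
RE-RUN at the separation `5/2` instead of `2h₀ = 2.52` (largest long-side cosine `κ = 1 − (5/4)²/2 = 7/32` instead of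
`κ₀ = 1031/5000`).  The declarations are namespace-shadowing COPIES of the tree's declarations (same names, inside
`namespace Summit.Ventures.Crystal3D.Kissing125[.KissingSearch]`, original docstrings and citation tags kept — the tags
name the printed METHOD step each declaration implements); the diff to the originals is stated per file.  Generated by
`HOME/lean/kissing125/gen/mkfiles.py`; audit recipe in `HOME/lean/kissing125/README.md`.  Nothing here is asserted
about GAP(1.26) or any census.

THIS FILE: (a) the predicate `IsKissingConfig25` (= `IsGapKissingConfig (5/2)` of `Bulk/GapReduction.lean`, same shape) with its `V/2` bookkeeping (copies of `FejesTothKissingTwelve` / `KissingFacetPenalty` Part C lemmas, separation `⟪·,·⟫ = 1/2 ∨ ≤ 7/32`); (b) `≤ 4` contacts at a point: copy of `KissingNodeDegree` Part D with `2h₀ ↦ 5/2` (numeric input `1 − (5/2)²/6 = −1/24 < 17/81`) and of `KissingUnitContactDegree`; (c) the geometric dictionary: copy of `KissingSearchGeometry.lean` (`IsKissingConfig ↦ IsKissingConfig25`, the structure `KConf` being the 7/32 one of `SearchDefs`), ending in `contactGraphFccOrHcp25_of_forall_concl`; (d) Lemma 10 at `σ = 4 − 2(5/4)² = 7/8 <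 8/9`: copy of `isArrangedIn_of_contactGraph_iso` (+ FCC/HCP corollaries) on the tree's generic `IsRealization` rigidity, and `isArrangedIn_of_forall_concl25`.  (Part 4 of 4: lines 822–914 of the transformed copy; the split is only for the 400-line rule.)

## References
* T. C. Hales, *A proof of Fejes Tóth's conjecture on sphere packings with kissing number twelve*,
  arXiv:1209.6043 (2012): Definition 1, Theorem 2 (main estimate `d₃`), Theorem 3, Lemmas 7–10. [`Hales2012`]
* R. E. Moore, *Interval Analysis* (1966), Theorem 3.1, §4.4. [`Moore1966`]
-/

noncomputable section

namespace Summit.Ventures.Crystal3D.Kissing125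
open Literature.Geometry.DiscreteGeometry
open Real RealInnerProductSpace InnerProductGeometry Finset

section Rigidity
open Real RealInnerProductSpace Finset

/-- **Lemma 10 for an enumerated model.** Let `S ∈ 𝒱` be a kissing configuration whose contact
graph is isomorphic to that of the model `2P = {refPt N (tab i)}`; if every realization of the
model's contact relation is congruent to the model (`rigid`), then `S` is arranged in the pattern
`P`. [cite: Hales2012, Lemma 10] -/
theorem isArrangedIn_of_contactGraph_iso {S : Set (EuclideanSpace ℝ (Fin 3))} (hS : IsKissingConfig25 S) {P : Finset (EuclideanSpace ℝ (Fin 3))}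
    {N : ℕ} (hN : N ≠ 0) {tab : Fin 12 → Fin 3 → ℤ} (htab : Function.Injective tab)
    (hP : (fun p => (2 : ℝ) • p) '' (P : Set (EuclideanSpace ℝ (Fin 3))) = Set.range fun i => refPt N (tab i))
    (rigid : ∀ {σ : ℝ} {x : Fin 12 → (EuclideanSpace ℝ (Fin 3))},
      IsRealization (fun i j => sqNormInt (tab i - tab j) = N) σ x →
        ∃ A : (EuclideanSpace ℝ (Fin 3)) →ₗᵢ[ℝ] (EuclideanSpace ℝ (Fin 3)), ∀ i, A (refPt N (tab i)) = x i)
    (e : contactGraph S ≃g contactGraph ((fun p => (2 : ℝ) • p) '' (P : Set (EuclideanSpace ℝ (Fin 3))))) :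
    IsArrangedIn S P := by
  set R : Set (EuclideanSpace ℝ (Fin 3)) := (fun p => (2 : ℝ) • p) '' (P : Set (EuclideanSpace ℝ (Fin 3))) with hR
  set ref : Fin 12 → (EuclideanSpace ℝ (Fin 3)) := fun i => refPt N (tab i) with href
  have memR : ∀ i, ref i ∈ R := fun i => by rw [hP]; exact Set.mem_range_self i
  set r : Fin 12 → R := fun i => ⟨ref i, memR i⟩ with hr
  have hrsurj : Function.Surjective r := by
    rintro ⟨p, hp⟩
    rw [hP] at hp
    obtain ⟨i, rfl⟩ := hp
    exact ⟨i, rfl⟩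
  have hrinj : Function.Injective r := fun i j hij =>
    htab (refPt_injective hN (by simpa [hr] using congrArg Subtype.val hij))
  set y : Fin 12 → S := fun i => e.symm (r i) with hy
  set x : Fin 12 → (EuclideanSpace ℝ (Fin 3)) := fun i => (y i : (EuclideanSpace ℝ (Fin 3))) with hxdef
  have hxmem : ∀ i, x i ∈ S := fun i => (y i).2
  have hnorm : ∀ i, ‖x i‖ = 2 := fun i => hS.norm_eq (hxmem i)
  have hadj : ∀ i j, dist (x i) (x j) = 2 ↔ sqNormInt (tab i - tab j) = N := fun i j => by
    rw [← dist_refPt_eq_two_iff hN]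
    change (contactGraph S).Adj (y i) (y j) ↔ (contactGraph R).Adj (r i) (r j)
    rw [hy]
    exact e.symm.map_adj_iff
  have hxinj : Function.Injective x := fun i j hij =>
    hrinj (e.symm.injective (Subtype.ext hij))
  -- `x` is a realization with `σ = 4 − 2(5/4)² = 7/8 < 8/9`
  have hreal :
      IsRealization (fun i j => sqNormInt (tab i - tab j) = N) (7 / 8 : ℝ) x := by
    refine ⟨by norm_num, fun i => ?_, fun i j hij => ?_, fun i j hij hn => ?_⟩
    · rw [real_inner_self_eq_norm_sq, hnorm]; norm_num
    · rw [inner_eq_of_norm_eq_two (hnorm i) (hnorm j), (hadj i j).2 hij]; norm_num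
    · have hne : x i ≠ x j := fun h => hij (hxinj h)
      have h2 : dist (x i) (x j) ≠ 2 := fun h => hn ((hadj i j).1 h)
      have hle := hS.le_dist_of_ne (hxmem i) (hxmem j) hne h2
      have h0 : (0 : ℝ) ≤ 5 / 2 := by norm_num
      rw [inner_eq_of_norm_eq_two (hnorm i) (hnorm j)]
      nlinarith [mul_le_mul hle hle h0 dist_nonneg]
  obtain ⟨A, hA⟩ := rigid hreal
  refine ⟨A, ?_⟩
  -- `S = range x = A '' R = {2 A p : p ∈ P}`
  have h1 : (fun p => (2 : ℝ) • A p) '' (P : Set (EuclideanSpace ℝ (Fin 3))) = A '' R := by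
    rw [hR, Set.image_image]
    simp only [map_smul]
  have h2 : A '' R = Set.range x := by
    rw [hP, ← Set.range_comp]
    exact congrArg Set.range (funext fun i => hA i)
  have h3 : Set.range x = S := by
    have hysurj : Function.Surjective y := e.symm.surjective.comp hrsurj
    rw [hxdef, Set.range_comp' Subtype.val y, hysurj.range_eq, Set.image_univ,
      Subtype.range_coe]
  rw [h1, h2, h3]

/-- **Hales 2012, Lemma 10 (FCC case), proved**: a kissing configuration `S ∈ 𝒱` whose contact
graph is isomorphic to that of the FCC configuration is congruent to it in `S²(2)`.
[cite: Hales2012, Lemma 10] -/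
theorem isArrangedIn_fcc_of_contactGraph_iso {S : Set (EuclideanSpace ℝ (Fin 3))} (hS : IsKissingConfig25 S)
    (e : contactGraph S ≃g contactGraph ((fun p => (2 : ℝ) • p) '' (fccKissingPattern : Set (EuclideanSpace ℝ (Fin 3))))) :
    IsArrangedIn S fccKissingPattern :=
  isArrangedIn_of_contactGraph_iso hS two_ne_zero fccTab_injective two_smul_image_fcc_eq_range
    (fun hx => fcc_rigid hx) e

/-- **Hales 2012, Lemma 10 (HCP case), proved**: a kissing configuration `S ∈ 𝒱` whose contact
graph is isomorphic to that of the HCP configuration is congruent to it in `S²(2)`.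
[cite: Hales2012, Lemma 10] -/
theorem isArrangedIn_hcp_of_contactGraph_iso {S : Set (EuclideanSpace ℝ (Fin 3))} (hS : IsKissingConfig25 S)
    (e : contactGraph S ≃g contactGraph ((fun p => (2 : ℝ) • p) '' (hcpKissingPattern : Set (EuclideanSpace ℝ (Fin 3))))) :
    IsArrangedIn S hcpKissingPattern :=
  isArrangedIn_of_contactGraph_iso hS (by norm_num) hcpTab_injective two_smul_image_hcp_eq_range
    (fun hx => hcp_rigid hx) e

/-- **BIMODAL(5/4), search form**: if every `KConf` at `κ = 7/32` has an FCC or HCP contact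
graph, every `V ∈ 𝒱(5/2)` is congruent to `2·fcc` or `2·hcp`. [cite: Hales2012, Lemma 10 and Theorem 3] -/
theorem isArrangedIn_of_forall_concl25 (h : ∀ M : Kissing125.KissingSearch.KConf, M.Concl) {S : Set (EuclideanSpace ℝ (Fin 3))}
    (hS : IsKissingConfig25 S) : IsArrangedIn S fccKissingPattern ∨ IsArrangedIn S hcpKissingPattern :=
  (contactGraphFccOrHcp25_of_forall_concl h hS).imp (fun ⟨e⟩ => isArrangedIn_fcc_of_contactGraph_iso hS e)
    fun ⟨e⟩ => isArrangedIn_hcp_of_contactGraph_iso hS e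

end Rigidity


end Summit.Ventures.Crystal3D.Kissing125

end


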